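import Summits.Ventures.PercRepro.ProfileGapMonoOne
import Summits.Ventures.PercRepro.ProfileGapMonoParallel

/-!
# PercRepro — `q`-GENERIC POINTS ARE GAP-MONOTONE: every point on no cocircuit of rank ≤ q satisfies `(GM)_q` given the
row `(q−1, u−1)` of the contraction (p10, gen 7; `proofs/P10-AVFULL.md` §15)

Call `z` **`q`-generic** in `M` (`GenericQ M z q`) if every set `X ⊆ E ∖ z` of rank `≤ q` has `z` in the closure of its
complement `E ∖ z ∖ X` — equivalently, every cocircuit of `M` through `z` has rank `≥ q + 1` off `z`.  Then in the regime
`ρ(E) ≥ u + q` (every rank-`u` set has co-rank `≥ q`, so the level sets are the plain ones and the new supply under the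
deletion of `z` is exactly the rank-`(u−1)` sets of `M ／ z`): the demand of a rank-`q` set `B ∌ z` does not change when
`z` is deleted (`demand_delete_eq_of_generic`), the rank-`q` sets through `z` are `B' ∪ z` for the rank-`(q−1)` sets
`B'` of `N := M ／ z` with `ρ_M(E' ∖ B') = ρ_N(E' ∖ B') + 1` (`demand_insert_of_generic`), and
`q · C(r+1, u−q) ≤ u · C(r, u−q)` (`choose_succ_mul_le`) turns the through-`z` demand into `(u/q)` times the row
`(q−1, u−1)` demand of `N`; the row `(q−1, u−1)` of `N` (an induction hypothesis in the reduction) closes it: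
**`gapMonoQ_of_generic`**.  So in `SimpleRuleQ` only simple matroids in which EVERY point lies on a cocircuit of rank
`≤ q` (and the levels `u > ρ(E) − q`) remain.

* `GenericQ`, `rk_gr_erase_of_generic`, `levelSetCoQ_eq_levelSet_of_rk`, `demand_delete_eq_of_generic`,
  `sum_Rq_filter_mem_contract`, `demand_insert_of_generic`, **`gapMonoQ_of_generic`**.
-/

open scoped Matroid

namespace PercRepro.Cogirth

open Finset ThmH Skew Shadow Profile

variable {α : Type} [DecidableEq α] {M : Matroid α} [M.Finite]

/-- **`q`-generic**: every subset of `E ∖ z` of rank `≤ q` has `z` in the closure of its complement in `E ∖ z`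
(no cocircuit through `z` has rank `≤ q` off `z`). -/
def GenericQ (M : Matroid α) [M.Finite] (z : α) (q : ℕ) : Prop :=
  ∀ X ⊆ (gr M).erase z, rk M X ≤ q → z ∈ clF M ((gr M).erase z \ X)

/-- A generic point is not a coloop: `ρ(E ∖ z) = ρ(E)`. -/
theorem rk_gr_erase_of_generic {z : α} (hz : z ∈ gr M) {q : ℕ} (hg : GenericQ M z q) :
    rk M ((gr M).erase z) = rk M (gr M) := by
  have h := hg ∅ (empty_subset _) (by
    have := rk_le_card (M := M) (∅ : Finset α)
    rw [card_empty] at this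
    omega)
  rw [sdiff_empty] at h
  have := rk_insert_eq (M := M) hz (X := (gr M).erase z) (erase_subset _ _)
  rw [insert_erase hz, if_pos h] at this
  exact this.symm

/-- In the regime `ρ(E) ≥ u + q` every rank-`u` set has co-rank `≥ q`: the co-rank level set is the level set. -/
theorem levelSetCoQ_eq_levelSet_of_rk {q u : ℕ} (hR : u + q ≤ rk M (gr M)) : levelSetCoQ M q u = levelSet M u := by
  ext S
  rw [mem_levelSetCoQ, mem_levelSet]
  constructor
  · exact fun h => h.1
  · intro h
    refine ⟨h, ?_⟩
    have h1 := rk_gr_le_rk_add_rk_sdiff (M := M) S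
    have h2 : rk M S = u := by
      have h' := h.2
      rw [← coe_rk] at h'
      exact_mod_cast h'
    omega

/-- At a generic point the demand of a rank-`q` set `B ∌ z` is the same in `M` and in `M ∖ z`. -/
theorem demand_delete_eq_of_generic {z : α} (hz : z ∈ gr M) {q : ℕ} (hg : GenericQ M z q) (u : ℕ)
    {B : Finset α} (hB : B ∈ Rq M q) (hzB : z ∉ B) :
    demand (M ＼ ({z} : Set α)) q u B = demand M q u B := by
  rw [demand_delete_eq_ite']
  unfold demand
  rw [mem_Rq] at hB
  have hBE : B ⊆ (gr M).erase z := subset_erase.2 ⟨hB.1, hzB⟩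
  have hBr : rk M B = q := by
    rw [← coe_rk] at hB
    exact_mod_cast hB.2
  have hcl := hg B hBE hBr.le
  have hset : (gr M \ B).erase z = (gr M).erase z \ B := by
    ext x
    simp only [mem_erase, mem_sdiff]
    tauto
  have hins : insert z ((gr M).erase z \ B) = gr M \ B := by
    ext x
    simp only [mem_insert, mem_sdiff, mem_erase]
    constructor
    · rintro (rfl | ⟨⟨_, hxE⟩, hxB⟩)
      · exact ⟨hz, hzB⟩
      · exact ⟨hxE, hxB⟩
    · rintro ⟨hxE, hxB⟩
      by_cases hxz : x = z
      · exact Or.inl hxz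
      · exact Or.inr ⟨⟨hxz, hxE⟩, hxB⟩
  have hrk : rk M (gr M \ B) = rk M ((gr M).erase z \ B) := by
    rw [← hins, rk_insert_eq hz (sdiff_subset.trans (erase_subset _ _)), if_pos hcl]
  rw [hset, hrk]

/-- The rank-`q` sets of `M` through a non-loop `z` are the rank-`(q−1)` sets of `M ／ z` with `z` inserted
(`q ≥ 1`). -/
theorem sum_Rq_filter_mem_contract {z : α} (hzI : M.Indep {z}) {q : ℕ} (hq : 1 ≤ q) (f : Finset α → ℕ) :
    ∑ B ∈ (Rq M q).filter (fun B => z ∈ B), f B = ∑ B' ∈ Rq (M ／ ({z} : Set α)) (q - 1), f (insert z B') := by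
  have hz : z ∈ gr M := mem_gr_of_indep hzI
  refine sum_nbij' (fun B => B.erase z) (fun B' => insert z B') ?_ ?_ ?_ ?_ ?_
  · intro B hB
    rw [mem_filter, mem_Rq] at hB
    obtain ⟨⟨hBg, hBr⟩, hzB⟩ := hB
    rw [mem_Rq, gr_contract']
    refine ⟨erase_subset_erase z hBg, ?_⟩
    have h := rk_contract_add_one hzI (X := B.erase z) (erase_subset_erase z hBg)
    rw [insert_erase hzB] at h
    have hBr' : rk M B = q := by
      rw [← coe_rk] at hBr
      exact_mod_cast hBr
    rw [← coe_rk]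
    congr 1
    omega
  · intro B' hB'
    rw [mem_Rq, gr_contract'] at hB'
    obtain ⟨hB'g, hB'r⟩ := hB'
    rw [mem_filter, mem_Rq]
    refine ⟨⟨insert_subset hz (hB'g.trans (erase_subset _ _)), ?_⟩, mem_insert_self _ _⟩
    have h := rk_contract_add_one hzI hB'g
    have hr' : rk (M ／ ({z} : Set α)) B' = q - 1 := by
      rw [← coe_rk] at hB'r
      exact_mod_cast hB'r
    rw [← coe_rk]
    congr 1
    omega
  · intro B hB
    rw [mem_filter] at hB
    exact insert_erase hB.2
  · intro B' hB'
    rw [mem_Rq, gr_contract'] at hB'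
    exact erase_insert (fun h => (mem_erase.1 (hB'.1 h)).1 rfl)
  · intro B hB
    rw [mem_filter] at hB
    rw [insert_erase hB.2]

/-- At a generic point, for a rank-`(q−1)` set `B'` of `N = M ／ z`: the demand of `B' ∪ z` in `M` is
`[u ≤ r+1] · C(r+1, u−q)` with `r := ρ_N(E' ∖ B')`. -/
theorem demand_insert_of_generic {z : α} (hzI : M.Indep {z}) {q : ℕ} (hq : 1 ≤ q) (hg : GenericQ M z q) (u : ℕ)
    {B' : Finset α} (hB' : B' ∈ Rq (M ／ ({z} : Set α)) (q - 1)) :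
    demand M q u (insert z B') =
      if u ≤ rk (M ／ ({z} : Set α)) (gr (M ／ ({z} : Set α)) \ B') + 1 then
        (rk (M ／ ({z} : Set α)) (gr (M ／ ({z} : Set α)) \ B') + 1).choose (u - q) else 0 := by
  have hz : z ∈ gr M := mem_gr_of_indep hzI
  rw [mem_Rq, gr_contract'] at hB'
  obtain ⟨hB'g, hB'r⟩ := hB'
  have hr' : rk (M ／ ({z} : Set α)) B' = q - 1 := by
    rw [← coe_rk] at hB'r
    exact_mod_cast hB'r
  -- `ρ_M(B') ≤ q`, so `z ∈ cl(E' ∖ B')`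
  have hMB' : rk M B' ≤ q := by
    have h1 := rk_contract_add_one hzI hB'g
    have h2 : rk M B' ≤ rk M (insert z B') := rk_mono_sub (subset_insert _ _)
    omega
  have hcl := hg B' hB'g hMB'
  have hset : gr M \ insert z B' = (gr M).erase z \ B' := by
    ext x
    simp only [mem_sdiff, mem_insert, mem_erase, not_or]
    tauto
  have hrk : rk (M ／ ({z} : Set α)) ((gr M).erase z \ B') + 1 = rk M ((gr M).erase z \ B') := by
    rw [rk_contract_add_one hzI sdiff_subset, rk_insert_eq hz (sdiff_subset.trans (erase_subset _ _)), if_pos hcl]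
  unfold demand
  rw [hset, gr_contract', ← hrk]

/-- **`q`-GENERIC POINTS ARE GAP-MONOTONE**: for `z` `q`-generic, `1 ≤ q < u`, `ρ(E) ≥ u + q`, the row `(q−1, u−1)` of
`M ／ z` gives `GapMonoQ M z q u`. -/
theorem gapMonoQ_of_generic {z : α} (hzI : M.Indep {z}) {q u : ℕ} (hq : 1 ≤ q) (hqu : q < u)
    (hg : GenericQ M z q) (hR : u + q ≤ rk M (gr M))
    (hdel : ProfileIneqMinusQ (M ／ ({z} : Set α)) (q - 1) (u - 1)) : GapMonoQ M z q u := by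
  have hz : z ∈ gr M := mem_gr_of_indep hzI
  unfold GapMonoQ
  unfold ProfileIneqMinusQ at hdel
  -- the level sets are the plain ones, in `M` and in `M ∖ z`
  have hL : levelSetCoQ M q u = levelSet M u := levelSetCoQ_eq_levelSet_of_rk hR
  have hL' : levelSetCoQ (M ＼ ({z} : Set α)) q u = levelSet (M ＼ ({z} : Set α)) u := by
    apply levelSetCoQ_eq_levelSet_of_rk
    rw [gr_delete', rk_delete (Subset.refl _), rk_gr_erase_of_generic hz hg]
    exact hR
  -- the demand sum of `M` splits at `z`
  have hD : ∑ B ∈ Rq M q, demand M q u B =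
      ∑ B ∈ Rq (M ＼ ({z} : Set α)) q, demand (M ＼ ({z} : Set α)) q u B +
      ∑ B' ∈ Rq (M ／ ({z} : Set α)) (q - 1), demand M q u (insert z B') := by
    rw [← sum_filter_add_sum_filter_not (Rq M q) (fun B => z ∈ B), sum_Rq_filter_mem_contract hzI hq,
      Rq_delete_eq_filter, add_comm]
    congr 1
    apply sum_congr rfl
    intro B hB
    rw [mem_filter] at hB
    rw [demand_delete_eq_of_generic hz hg u hB.1 hB.2]
  -- the through-`z` demand against the row `(q−1, u−1)` of `N`
  have hthrough : q * ∑ B' ∈ Rq (M ／ ({z} : Set α)) (q - 1), demand M q u (insert z B') ≤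
      u * ∑ B' ∈ Rq (M ／ ({z} : Set α)) (q - 1), demand (M ／ ({z} : Set α)) (q - 1) (u - 1) B' := by
    rw [mul_sum, mul_sum]
    apply sum_le_sum
    intro B' hB'
    rw [demand_insert_of_generic hzI hq hg u hB']
    unfold demand
    split_ifs with h1 h2 h2
    · rw [show u - 1 - (q - 1) = u - q by omega]
      exact choose_succ_mul_le hq hqu (by omega)
    · omega
    · omega
    · exact le_refl _
  have hcq : u * (u - 1).choose (q - 1) = q * u.choose q := by
    have := Nat.add_one_mul_choose_eq (u - 1) (q - 1)
    rw [show u - 1 + 1 = u by omega, show q - 1 + 1 = q by omega] at this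
    rw [this]
    ring
  have hsub : (levelSetCoQ (M ／ ({z} : Set α)) (q - 1) (u - 1)).card ≤ (levelSet (M ／ ({z} : Set α)) (u - 1)).card :=
    card_le_card (filter_subset _ _)
  have hsplit := card_levelSet_split hzI (u := u) (by omega)
  rw [hD, hL, hL', hsplit]
  -- `q · T ≤ u · D'' ≤ u · C(u−1,q−1) · W⁻'' ≤ q · C(u,q) · W''`
  have hkey : q * ∑ B' ∈ Rq (M ／ ({z} : Set α)) (q - 1), demand M q u (insert z B') ≤
      q * (u.choose q * (levelSet (M ／ ({z} : Set α)) (u - 1)).card) := by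
    calc q * ∑ B' ∈ Rq (M ／ ({z} : Set α)) (q - 1), demand M q u (insert z B')
        ≤ u * ∑ B' ∈ Rq (M ／ ({z} : Set α)) (q - 1), demand (M ／ ({z} : Set α)) (q - 1) (u - 1) B' := hthrough
      _ ≤ u * ((u - 1).choose (q - 1) * (levelSetCoQ (M ／ ({z} : Set α)) (q - 1) (u - 1)).card) :=
          Nat.mul_le_mul_left _ hdel
      _ ≤ u * ((u - 1).choose (q - 1) * (levelSet (M ／ ({z} : Set α)) (u - 1)).card) :=
          Nat.mul_le_mul_left _ (Nat.mul_le_mul_left _ hsub)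
      _ = (u * (u - 1).choose (q - 1)) * (levelSet (M ／ ({z} : Set α)) (u - 1)).card := by ring
      _ = (q * u.choose q) * (levelSet (M ／ ({z} : Set α)) (u - 1)).card := by rw [hcq]
      _ = q * (u.choose q * (levelSet (M ／ ({z} : Set α)) (u - 1)).card) := by ring
  have hT : ∑ B' ∈ Rq (M ／ ({z} : Set α)) (q - 1), demand M q u (insert z B') ≤
      u.choose q * (levelSet (M ／ ({z} : Set α)) (u - 1)).card := Nat.le_of_mul_le_mul_left hkey (by omega)
  have e1 : u.choose q * ((levelSet (M ＼ ({z} : Set α)) u).card + (levelSet (M ／ ({z} : Set α)) (u - 1)).card) =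
      u.choose q * (levelSet (M ＼ ({z} : Set α)) u).card + u.choose q * (levelSet (M ／ ({z} : Set α)) (u - 1)).card := by
    ring
  rw [e1]
  omega

end PercRepro.Cogirth
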